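import Mathlib
import Summits.NavierStokesRegularity.NavierStokesRegularity.Theorems.EulerZoomLiouvillePowerGaugeEulerLiouvilleCondenserThinWindowGap

/-!
# THEOREM K^Σ′ — THE WINDOW-SUMMABILITY LIOUVILLE THEOREM, MASTER FORM, and K^Σ (nsreg-p2 g37 ROUND-47 v1.2/v1.3 §5/§5b
«K″'s threshold is an artefact of (W2)»; plates t50-KΣ′ `NsregP2.R47.WindowSummabilityLiouville` and t50-KΣ
`NsregP2.R47.SummabilityLiouville`, texts `r47/Sketch47.lean` v1.3 sha16 f89f412bf4150db7, binder-for-binder)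

Width piece for crux `EulerZoomLiouville.PowerGaugeEulerLiouville` (stmt-NavierStokesRegularity-19832), by name under LEAD 19832
(ns-typeII-p2 g14); seat ns-sfl-p1 g7 (K∞/K^Σ assembler), `--supports stmt-NavierStokesRegularity-19832 --as helper`.

The CEILING of the capacity method.  For ANY `q > 1` and ANY family of pairwise disjoint windows `[ℓ_k, qℓ_k)` (`qℓ_k ≤ ℓ_{k+1}`)
with envelopes `‖DV‖ ≤ exp(G_k)` on `B(0,qℓ_k)` (`G_k ≥ 1`): `Σ_k ℓ_k^{2+ρ}/G_k = ∞` ⇒ an exactly self-similar `C²` member of the crux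
class is trivial.  Proof = THEOREM K″'s per-window step (`Condenser.selfSimilar_ae_eq_zero_of_thinWindowSmallTypeGradientC2`,
p682751: cut-off copy on `B(0,(q+1)ℓ_k)`, exit from `B(0,ℓ_k)` through `‖·‖ = qℓ_k` or else `curl V x = 0` by K′'s
`curl_eq_zero_of_noexit`, (B″_g) `shellCondenserGaugeForm` with the fixed loss `θ = ½`) for every tail window: it pays
`F(qℓ_k) − F(ℓ_k) ≥ κ ℓ_k³/G_k`, `κ = θ2πγ²(q³−1)/3 > 0`; then the GLOBAL WEIGHTED budget `∫ ‖DV‖²‖y‖^{ρ−1} ≤ (1−ρ)c/(2+ρ)`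
(`NeedleThinCore.selfSimilar_needle_inputs`, 2nd conjunct) through the two plates (W4′) `WeightedWindowBudget` and (W4)
`WindowSummation` (texts VERBATIM, taken as HYPOTHESES `hW4'`, `hW4` of the `_of` theorem; typed by ns-ezl-w2 g5) makes the tail
series summable — contradiction (`summable_nat_add_iff`).

* `selfSimilar_ae_eq_zero_of_windowDivergentC2_of hW4' hW4` — the master form with the two plates as hypotheses;
* `windowSummabilityLiouville_of hW4' hW4` — `NsregP2.R47.WindowSummabilityLiouville` VERBATIM from the two plates;
* `summabilityLiouville_of hW4' hW4` — `NsregP2.R47.SummabilityLiouville` VERBATIM (geometric windows `ℓ_k = qᵏR₀`,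
  `G_k = G(q^{k+1}R₀)`).  Corollaries (elsewhere / trivial): K∞ `finiteTypeLiouville`, the LEAD's T3 (`…CondenserInfiniteType`).

HONEST FRAMING: stratum statements about HYPOTHETICAL exactly self-similar `C²` members of crux E's class (MODEL lattice), CONDITIONAL
on the two S-plates until they land by name; nothing here proves the crux E (19832 OPEN), any door Target, or Navier–Stokes
regularity. [nsreg-p2 ROUND-47 v1.3 THEOREM K^Σ′; cite: ConstantinIgnatovaVicol2026Putative, §3.4.1; folklore (length–area method)]
-/

noncomputable section

open Set Filter Topology Metric Function MeasureTheory Real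
open scoped RealInnerProductSpace NNReal ENNReal

set_option linter.dupNamespace false

namespace Summit.NavierStokesRegularity.NavierStokesRegularity.Theorems.PowerGaugeEulerLiouville.Condenser

open Literature.Analysis Literature.Analysis.FluidPDE
open Summit.NavierStokesRegularity.NavierStokesRegularity.Theorems.PowerGaugeEulerLiouville

/-- **THEOREM K^Σ′ — MASTER FORM, from the plates (W4′), (W4) as hypotheses.**  See the module docstring.
[nsreg-p2 ROUND-47 v1.3 THEOREM K^Σ′; cite: ConstantinIgnatovaVicol2026Putative, §3.4.1; folklore (length–area method)] -/
theorem selfSimilar_ae_eq_zero_of_windowDivergentC2_of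
    (hW4' : (∀ (V : EuclideanSpace ℝ (Fin 3) → EuclideanSpace ℝ (Fin 3)) (ρ B q : ℝ) (ℓ : ℕ → ℝ), ContDiff ℝ 1 V → ρ < 1 → 1 < q →
      (∀ k : ℕ, 0 < ℓ k) → (∀ k : ℕ, q * ℓ k ≤ ℓ (k + 1)) → 0 ≤ B →
      ∫⁻ y, ‖fderiv ℝ V y‖ₑ ^ 2 * ENNReal.ofReal (‖y‖ ^ (ρ - 1)) ≤ ENNReal.ofReal B →
      ∀ n : ℕ, ∑ k ∈ Finset.range n,
          (q * ℓ k) ^ (ρ - 1) *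
            ((∫ z in ball (0 : EuclideanSpace ℝ (Fin 3)) (q * ℓ k), ‖fderiv ℝ V z‖ ^ 2) -
              ∫ z in ball (0 : EuclideanSpace ℝ (Fin 3)) (ℓ k), ‖fderiv ℝ V z‖ ^ 2) ≤ B))
    (hW4 : (∀ (F : ℝ → ℝ) (ρ κ q B : ℝ) (ℓ G : ℕ → ℝ), ρ < 1 → 1 < q → 0 < κ → (∀ k : ℕ, 0 < ℓ k) → (∀ k : ℕ, 0 < G k) →
      (∀ n : ℕ, ∑ k ∈ Finset.range n, (q * ℓ k) ^ (ρ - 1) * (F (q * ℓ k) - F (ℓ k)) ≤ B) →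
      (∀ k : ℕ, κ * ℓ k ^ 3 / G k ≤ F (q * ℓ k) - F (ℓ k)) →
      Summable (fun k : ℕ => ℓ k ^ (2 + ρ) / G k)))
    {ρ : ℝ} (hρ : 0 < ρ) (hρ1 : ρ ≤ 1 / 2)
    {u : ℝ → EuclideanSpace ℝ (Fin 3) → EuclideanSpace ℝ (Fin 3)} {p : ℝ → EuclideanSpace ℝ (Fin 3) → ℝ}
    {H : ℝ → EuclideanSpace ℝ (Fin 3) → EuclideanSpace ℝ (Fin 3) →L[ℝ] EuclideanSpace ℝ (Fin 3)} {c : ℝ≥0}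
    (hc : 0 < (c : ℝ))
    (hsw : IsSuitableWeakSolutionOn (slab (EuclideanSpace ℝ (Fin 3)) (Iio 0) isOpen_Iio) 0 0 u p)
    (hH : HasWeakSpatialGradientOn (slab (EuclideanSpace ℝ (Fin 3)) (Iio 0) isOpen_Iio) u H)
    (hgauge : ∀ a : ℝ, 0 < a →
      ENNReal.ofReal (a ^ (2 * ρ)) * cknA a (0 : ℝ × EuclideanSpace ℝ (Fin 3)) u +
          ENNReal.ofReal (a ^ ρ) * cknE a (0 : ℝ × EuclideanSpace ℝ (Fin 3)) H +
        ENNReal.ofReal (a ^ (2 * ρ)) * cknD a (0 : ℝ × EuclideanSpace ℝ (Fin 3)) p ≤ (c : ℝ≥0∞))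
    {V : EuclideanSpace ℝ (Fin 3) → EuclideanSpace ℝ (Fin 3)} {P : EuclideanSpace ℝ (Fin 3) → ℝ}
    (hu : ∀ τ : ℝ, τ < 0 → u τ = selfSimilarCollapse (1 / (2 + ρ)) 0 V τ)
    (hp : ∀ τ : ℝ, τ < 0 → p τ = selfSimilarCollapsePressure (1 / (2 + ρ)) 0 P τ)
    (hV : ContDiff ℝ 2 V)
    {q : ℝ} {ℓ G : ℕ → ℝ} (hq : 1 < q) (hℓpos : ∀ k : ℕ, 0 < ℓ k) (hsep : ∀ k : ℕ, q * ℓ k ≤ ℓ (k + 1))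
    (hG1 : ∀ k : ℕ, 1 ≤ G k)
    (henv : ∀ k : ℕ, ∀ z ∈ ball (0 : EuclideanSpace ℝ (Fin 3)) (q * ℓ k), ‖fderiv ℝ V z‖ ≤ Real.exp (G k))
    (hdiv : ¬ Summable (fun k : ℕ => ℓ k ^ (2 + ρ) / G k)) :
    uncurry u =ᵐ[volume.restrict (Iio (0 : ℝ) ×ˢ (univ : Set (EuclideanSpace ℝ (Fin 3))))] 0 := by
  have hπ : 0 < Real.pi := Real.pi_pos
  have hρ1' : ρ < 1 := by linarith
  have h2ρ : (0 : ℝ) < 2 + ρ := by linarith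
  have h1ρ : (0 : ℝ) < 1 - ρ := by linarith
  have hγ : (0 : ℝ) < 1 / (2 + ρ) := one_div_pos.2 h2ρ
  have hγ2 : 1 / (2 + ρ) < 1 / 2 := one_div_lt_one_div_of_lt two_pos (by linarith)
  have hV1 : ContDiff ℝ 1 V := hV.of_le (by norm_num)
  -- ### a classical pressure for the profile
  have hA : ∀ a : ℝ, 0 < a → ENNReal.ofReal (a ^ (2 * ρ)) *
      cknA a (0 : ℝ × EuclideanSpace ℝ (Fin 3)) u ≤ (c : ℝ≥0∞) :=
    fun a ha => le_trans (le_trans le_self_add le_self_add) (hgauge a ha)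
  have hD : ∀ a : ℝ, 0 < a → ENNReal.ofReal (a ^ (2 * ρ)) *
      cknD a (0 : ℝ × EuclideanSpace ℝ (Fin 3)) p ≤ (c : ℝ≥0∞) :=
    fun a ha => le_trans le_add_self (hgauge a ha)
  have hpm : AEStronglyMeasurable (uncurry p)
      (volume.restrict (Iio (0 : ℝ) ×ˢ (univ : Set (EuclideanSpace ℝ (Fin 3))))) := by
    have := hsw.distributional.2.2.1.aestronglyMeasurable
    simpa [slab] using this
  have hPm := aestronglyMeasurable_pressureProfile hpm hp
  have hDprof := profile_pressure_weight_of_gaugeD hρ hρ1' hpm hp hD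
  have hP1 : LocallyIntegrable P volume :=
    EnergySaturation.locallyIntegrable_pressure_of_weight hρ1' hPm
      (ENNReal.mul_ne_top ENNReal.ofReal_ne_top ENNReal.coe_ne_top) hDprof
  obtain ⟨P', hprof⟩ :=
    WeakToClassical.exists_isSelfSimilarEulerProfile_of_contDiff hsw.distributional hu hp hV hP1
  -- ### the class budgets of the profile on balls (`0 < c`)
  obtain ⟨hA', hE'⟩ :=
    NeedleThinCore.selfSimilar_needle_inputs hρ hρ1' hsw hH hgauge hu hp hV1
  obtain ⟨CA, hCA⟩ : ∃ CA : ℝ, CA = (c : ℝ) := ⟨_, rfl⟩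
  have hE0 : 0 ≤ (1 - ρ) / (2 + ρ) * (c : ℝ) := by positivity
  have hCApos : 0 < CA := by rw [hCA]; exact hc
  have hbA : ∀ r : ℝ, 0 < r →
      ∫ x in ball (0 : EuclideanSpace ℝ (Fin 3)) r, ‖V x‖ ^ 2 ≤ CA * r ^ (1 - 2 * ρ) := by
    intro r hr
    have hX : 0 ≤ CA * r ^ (1 - 2 * ρ) := by positivity
    refine setIntegral_sq_le_of_lintegral hV.continuous hX ((hA' r hr).trans ?_)
    rw [hCA, ← ENNReal.ofReal_coe_nnreal, ← ENNReal.ofReal_mul (NNReal.coe_nonneg c)]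
  -- ### FIXED loss `θ = 1/2`; the windows grow at least geometrically
  obtain ⟨θ, hθdef⟩ : ∃ θ : ℝ, θ = 1 / 2 := ⟨_, rfl⟩
  have hθ0 : 0 < θ := by rw [hθdef]; norm_num
  have hθ1 : θ < 1 := by rw [hθdef]; norm_num
  have hq0 : 0 < q := by linarith
  have hℓgrow : ∀ k : ℕ, q ^ k * ℓ 0 ≤ ℓ k := by
    intro k
    induction k with
    | zero => simp
    | succ k ih =>
      calc q ^ (k + 1) * ℓ 0 = q * (q ^ k * ℓ 0) := by rw [pow_succ]; ring
        _ ≤ q * ℓ k := mul_le_mul_of_nonneg_left ih hq0.le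
        _ ≤ ℓ (k + 1) := hsep k
  have hℓlarge : ∀ M : ℝ, ∃ k₀ : ℕ, ∀ k : ℕ, k₀ ≤ k → M ≤ ℓ k := by
    intro M
    obtain ⟨k₀, hk₀⟩ := pow_unbounded_of_one_lt (M / ℓ 0) hq
    refine ⟨k₀, fun k hk => ?_⟩
    have h1 : M / ℓ 0 < q ^ k := hk₀.trans_le (pow_le_pow_right₀ hq.le hk)
    have h2 : M < q ^ k * ℓ 0 := by rwa [div_lt_iff₀ (hℓpos 0)] at h1
    exact h2.le.trans (hℓgrow k)
  -- ### the shell condenser in gauge form at `(γ, ρ, C_A, q, θ)`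
  obtain ⟨R₁, hR₁, hBg⟩ := shellCondenserGaugeForm (1 / (2 + ρ)) ρ CA q θ hγ hρ.le hCApos hq hθ0 hθ1
  -- the window constant `κ` and the Dirichlet counting function `F`
  obtain ⟨κw, hκdef⟩ : ∃ κw : ℝ, κw = θ * (2 * Real.pi * (1 / (2 + ρ)) ^ 2 * (q ^ 3 - 1)) / 3 := ⟨_, rfl⟩
  have hq3 : 0 < q ^ 3 - 1 := by nlinarith [pow_lt_pow_left₀ hq zero_le_one three_ne_zero]
  have hκpos : 0 < κw := by rw [hκdef]; positivity
  set F : ℝ → ℝ := fun t => ∫ z in ball (0 : EuclideanSpace ℝ (Fin 3)) t, ‖fderiv ℝ V z‖ ^ 2 with hF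
  have hDVc : Continuous fun z => ‖fderiv ℝ V z‖ ^ 2 := (hV.continuous_fderiv (by norm_num)).norm.pow 2
  have hFint : ∀ t : ℝ, IntegrableOn (fun z => ‖fderiv ℝ V z‖ ^ 2) (ball (0 : EuclideanSpace ℝ (Fin 3)) t) volume :=
    fun t => (hDVc.continuousOn.integrableOn_compact (isCompact_closedBall 0 t)).mono_set ball_subset_closedBall
  have hF0 : ∀ t, 0 ≤ F t := fun t => setIntegral_nonneg measurableSet_ball fun z _ => sq_nonneg _
  -- ### the profile is irrotational
  have hcurl : ∀ x : EuclideanSpace ℝ (Fin 3), curl V x = 0 := by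
    intro x
    by_contra hxc
    -- a tail `k ≥ k₀` of the windows beyond `max(R₁, 1, ‖x‖+1)`
    obtain ⟨k₀, hk₀⟩ := hℓlarge (max (max R₁ 1) (‖x‖ + 1))
    have hℓk : ∀ k : ℕ, R₁ ≤ ℓ (k₀ + k) ∧ 1 ≤ ℓ (k₀ + k) ∧ ‖x‖ + 1 ≤ ℓ (k₀ + k) := by
      intro k
      have h := hk₀ (k₀ + k) (Nat.le_add_right _ _)
      exact ⟨((le_max_left _ _).trans (le_max_left _ _)).trans h, ((le_max_right _ _).trans (le_max_left _ _)).trans h,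
        (le_max_right _ _).trans h⟩
    -- every tail window pays `κ ℓ_k³ / G_k`
    have hwin : ∀ k : ℕ, κw * ℓ (k₀ + k) ^ 3 / G (k₀ + k) ≤ F (q * ℓ (k₀ + k)) - F (ℓ (k₀ + k)) := by
      intro k
      obtain ⟨hR₁ℓ, hℓ1, hxℓ⟩ := hℓk k
      set l : ℝ := ℓ (k₀ + k) with hl
      have hl0 : 0 < l := hℓpos _
      have hGk : 0 < G (k₀ + k) := zero_lt_one.trans_le (hG1 _)
      have hql : l ≤ q * l := le_mul_of_one_le_left hl0.le hq.le
      -- the shell budget `S = F(ql) − F(l)`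
      have hshell : F (q * l) - F l =
          ∫ z in ball (0 : EuclideanSpace ℝ (Fin 3)) (q * l) ∩ {x | l ≤ ‖x‖}, ‖fderiv ℝ V z‖ ^ 2 := by
        rw [← ball_sdiff_ball_eq_shell, setIntegral_sdiff measurableSet_ball (hFint _) (ball_subset_ball hql)]
      have hSl0 : 0 ≤ ∫ z in ball (0 : EuclideanSpace ℝ (Fin 3)) (q * l) ∩ {x | l ≤ ‖x‖}, ‖fderiv ℝ V z‖ ^ 2 :=
        setIntegral_nonneg (measurableSet_ball.inter (measurableSet_le measurable_const continuous_norm.measurable))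
          fun z _ => sq_nonneg _
      by_contra hlt
      push Not at hlt
      rw [hshell] at hlt
      -- a budget `S` strictly between `S_l` and the cost
      have hcost : 0 < κw * l ^ 3 / G (k₀ + k) := by positivity
      obtain ⟨S, hSdef⟩ : ∃ S : ℝ, S =
          ((∫ z in ball (0 : EuclideanSpace ℝ (Fin 3)) (q * l) ∩ {x | l ≤ ‖x‖}, ‖fderiv ℝ V z‖ ^ 2) +
            κw * l ^ 3 / G (k₀ + k)) / 2 := ⟨_, rfl⟩
      have hS : 0 < S := by rw [hSdef]; linarith
      have hSlS : (∫ z in ball (0 : EuclideanSpace ℝ (Fin 3)) (q * l) ∩ {x | l ≤ ‖x‖}, ‖fderiv ℝ V z‖ ^ 2) ≤ S := by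
        rw [hSdef]; linarith
      have hSa : S < κw * l ^ 3 / G (k₀ + k) := by rw [hSdef]; linarith
      -- a `C²` cut-off copy agreeing with `V` on `B(0,(q+1)l)`
      obtain ⟨Vc, hVc2, -, -, ⟨K, hK⟩, hVU⟩ := Loc.exists_cutoff_local hV (R := (q + 1) * l) (by positivity)
      have hVc1 : ContDiff ℝ 1 Vc := hVc2.of_le (by norm_num)
      have hsub : ball (0 : EuclideanSpace ℝ (Fin 3)) (q * l) ⊆ ball (0 : EuclideanSpace ℝ (Fin 3)) ((q + 1) * l) :=
        ball_subset_ball (by linarith)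
      have hfd : ∀ z ∈ ball (0 : EuclideanSpace ℝ (Fin 3)) ((q + 1) * l), fderiv ℝ Vc z = fderiv ℝ V z := fun z hz =>
        Filter.EventuallyEq.fderiv_eq (Filter.eventually_of_mem (isOpen_ball.mem_nhds hz) hVU)
      -- an exit from `B(0,l)` through `‖·‖ = ql` must exist, else `curl V x = 0`
      have hex : ∃ (y : EuclideanSpace ℝ (Fin 3)) (L : ℝ), ‖y‖ < l ∧ 0 ≤ L ∧
          q * l ≤ ‖ODE.evolutionMap (fun _ : ℝ => selfSimilarTransport (1 / (2 + ρ)) 0 Vc) 0 (-L) y‖ := by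
        by_contra hne
        push Not at hne
        exact hxc (curl_eq_zero_of_noexit hprof hγ hγ2 hV hVc1 hK hl0 hq hVU
          (fun y hy L hL => hne y L hy hL) (by linarith))
      obtain ⟨y, L, hy, hL, hexit⟩ := hex
      -- budgets of the cut-off copy
      have hAc : ∫ z in ball (0 : EuclideanSpace ℝ (Fin 3)) (q * l), ‖Vc z‖ ^ 2 ≤ CA * (q * l) ^ (1 - 2 * ρ) := by
        rw [setIntegral_congr_fun measurableSet_ball (fun z hz => by rw [hVU z (hsub hz)])]
        exact hbA _ (by positivity)
      have hEc : ∫ z in ball (0 : EuclideanSpace ℝ (Fin 3)) (q * l) ∩ {x : EuclideanSpace ℝ (Fin 3) | l ≤ ‖x‖},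
          ‖fderiv ℝ Vc z‖ ^ 2 ≤ S := by
        rw [setIntegral_congr_fun
          (measurableSet_ball.inter (measurableSet_le measurable_const continuous_norm.measurable))
          (fun z hz => by rw [hfd z (hsub hz.1)])]
        exact hSlS
      -- (B″_g) … under the envelope `exp(G_k)` on `B(0,ql)`
      obtain ⟨z, hz, hzle⟩ := hBg Vc K hVc1 hK l S hR₁ℓ hS hAc hEc y L hL hy hexit
      rw [hfd z (hsub hz)] at hzle
      have hineq := Real.exp_le_exp.1 (hzle.trans (henv (k₀ + k) z hz))
      -- `κ l³ / G_k ≤ S`, contradicting `S < κ l³/G_k`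
      have hfin : κw * l ^ 3 / G (k₀ + k) ≤ S := by
        rw [div_le_iff₀ hGk]
        have h1 : θ * (2 * Real.pi * (1 / (2 + ρ)) ^ 2 * (q ^ 3 - 1) * l ^ 3 / (3 * S)) * (3 * S) ≤ G (k₀ + k) * (3 * S) :=
          mul_le_mul_of_nonneg_right hineq (by positivity)
        have e1 : θ * (2 * Real.pi * (1 / (2 + ρ)) ^ 2 * (q ^ 3 - 1) * l ^ 3 / (3 * S)) * (3 * S) = 3 * (κw * l ^ 3) := by
          rw [hκdef]; field_simp
        rw [e1] at h1
        nlinarith [h1]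
      linarith
    -- (W4′)+(W4) on the tail family: the divergent series would be summable
    have hℓpos' : ∀ k : ℕ, 0 < ℓ (k₀ + k) := fun k => hℓpos _
    have hsep' : ∀ k : ℕ, q * ℓ (k₀ + k) ≤ ℓ (k₀ + (k + 1)) := fun k => by rw [← add_assoc]; exact hsep _
    have hGpos' : ∀ k : ℕ, 0 < G (k₀ + k) := fun k => zero_lt_one.trans_le (hG1 _)
    have hsum : ∀ n : ℕ, ∑ k ∈ Finset.range n,
        (q * ℓ (k₀ + k)) ^ (ρ - 1) * (F (q * ℓ (k₀ + k)) - F (ℓ (k₀ + k))) ≤ (1 - ρ) / (2 + ρ) * (c : ℝ) :=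
      fun n => hW4' V ρ _ q (fun k => ℓ (k₀ + k)) hV1 hρ1' hq hℓpos' hsep' hE0 hE' n
    have hsumm : Summable (fun k : ℕ => ℓ (k₀ + k) ^ (2 + ρ) / G (k₀ + k)) :=
      hW4 F ρ κw q _ (fun k => ℓ (k₀ + k)) (fun k => G (k₀ + k)) hρ1' hq hκpos hℓpos' hGpos' hsum hwin
    have hsumm' : Summable (fun k : ℕ => ℓ k ^ (2 + ρ) / G k) := by
      rw [← summable_nat_add_iff k₀]
      refine hsumm.congr fun k => ?_
      rw [add_comm]
    exact hdiv hsumm'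
  -- ### conclusion
  exact Loc.selfSimilar_ae_eq_zero_of_irrotationalC2_profile hρ hsw.distributional hA hu hV hcurl


/-- **(K^Σ′) `NsregP2.R47.WindowSummabilityLiouville` from the plates (W4′), (W4)** (Sketch47 v1.3 of nsreg-p2 g37, sha16
f89f412bf4150db7, plate t50-KΣ′; `E3` spelled out; the conclusion is the text VERBATIM). [nsreg-p2 ROUND-47 v1.3 THEOREM K^Σ′;
cite: ConstantinIgnatovaVicol2026Putative, §3.4.1; folklore (length–area method)] -/
theorem windowSummabilityLiouville_of
    (hW4' : (∀ (V : EuclideanSpace ℝ (Fin 3) → EuclideanSpace ℝ (Fin 3)) (ρ B q : ℝ) (ℓ : ℕ → ℝ), ContDiff ℝ 1 V → ρ < 1 → 1 < q →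
      (∀ k : ℕ, 0 < ℓ k) → (∀ k : ℕ, q * ℓ k ≤ ℓ (k + 1)) → 0 ≤ B →
      ∫⁻ y, ‖fderiv ℝ V y‖ₑ ^ 2 * ENNReal.ofReal (‖y‖ ^ (ρ - 1)) ≤ ENNReal.ofReal B →
      ∀ n : ℕ, ∑ k ∈ Finset.range n,
          (q * ℓ k) ^ (ρ - 1) *
            ((∫ z in ball (0 : EuclideanSpace ℝ (Fin 3)) (q * ℓ k), ‖fderiv ℝ V z‖ ^ 2) -
              ∫ z in ball (0 : EuclideanSpace ℝ (Fin 3)) (ℓ k), ‖fderiv ℝ V z‖ ^ 2) ≤ B))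
    (hW4 : (∀ (F : ℝ → ℝ) (ρ κ q B : ℝ) (ℓ G : ℕ → ℝ), ρ < 1 → 1 < q → 0 < κ → (∀ k : ℕ, 0 < ℓ k) → (∀ k : ℕ, 0 < G k) →
      (∀ n : ℕ, ∑ k ∈ Finset.range n, (q * ℓ k) ^ (ρ - 1) * (F (q * ℓ k) - F (ℓ k)) ≤ B) →
      (∀ k : ℕ, κ * ℓ k ^ 3 / G k ≤ F (q * ℓ k) - F (ℓ k)) →
      Summable (fun k : ℕ => ℓ k ^ (2 + ρ) / G k))) :
    ∀ (ρ : ℝ), 0 < ρ → ρ ≤ 1 / 2 →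
      ∀ (u : ℝ → EuclideanSpace ℝ (Fin 3) → EuclideanSpace ℝ (Fin 3)) (p : ℝ → EuclideanSpace ℝ (Fin 3) → ℝ)
        (H : ℝ → EuclideanSpace ℝ (Fin 3) → EuclideanSpace ℝ (Fin 3) →L[ℝ] EuclideanSpace ℝ (Fin 3)) (c : ℝ≥0), 0 < (c : ℝ) →
        IsSuitableWeakSolutionOn (slab (EuclideanSpace ℝ (Fin 3)) (Iio 0) isOpen_Iio) 0 0 u p →
        HasWeakSpatialGradientOn (slab (EuclideanSpace ℝ (Fin 3)) (Iio 0) isOpen_Iio) u H →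
        (∀ a : ℝ, 0 < a →
          ENNReal.ofReal (a ^ (2 * ρ)) * cknA a (0 : ℝ × EuclideanSpace ℝ (Fin 3)) u +
              ENNReal.ofReal (a ^ ρ) * cknE a (0 : ℝ × EuclideanSpace ℝ (Fin 3)) H +
            ENNReal.ofReal (a ^ (2 * ρ)) * cknD a (0 : ℝ × EuclideanSpace ℝ (Fin 3)) p ≤ (c : ℝ≥0∞)) →
        ∀ (V : EuclideanSpace ℝ (Fin 3) → EuclideanSpace ℝ (Fin 3)) (P : EuclideanSpace ℝ (Fin 3) → ℝ),
          (∀ τ : ℝ, τ < 0 → u τ = selfSimilarCollapse (1 / (2 + ρ)) 0 V τ) →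
          (∀ τ : ℝ, τ < 0 → p τ = selfSimilarCollapsePressure (1 / (2 + ρ)) 0 P τ) →
          ContDiff ℝ 2 V →
          ∀ (q : ℝ) (ℓ G : ℕ → ℝ), 1 < q → (∀ k : ℕ, 0 < ℓ k) → (∀ k : ℕ, q * ℓ k ≤ ℓ (k + 1)) → (∀ k : ℕ, 1 ≤ G k) →
            (∀ k : ℕ, ∀ z ∈ ball (0 : EuclideanSpace ℝ (Fin 3)) (q * ℓ k), ‖fderiv ℝ V z‖ ≤ Real.exp (G k)) →
            ¬ Summable (fun k : ℕ => ℓ k ^ (2 + ρ) / G k) →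
          uncurry u =ᵐ[volume.restrict (Iio (0 : ℝ) ×ˢ (univ : Set (EuclideanSpace ℝ (Fin 3))))] 0 :=
  fun _ hρ hρ1 _ _ _ _ hc hsw hH hgauge _ _ hu hp hV _ _ _ hq hℓpos hsep hG1 henv hdiv =>
    selfSimilar_ae_eq_zero_of_windowDivergentC2_of hW4' hW4 hρ hρ1 hc hsw hH hgauge hu hp hV hq hℓpos hsep hG1 henv hdiv

/-- **(K^Σ) `NsregP2.R47.SummabilityLiouville` from the plates (W4′), (W4)** (Sketch47 v1.2/v1.3, plate t50-KΣ; `E3` spelled out; the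
conclusion is the text VERBATIM): the geometric family `ℓ_k = qᵏR₀`, `G_k = G(q^(k+1) R₀)` of the master form. [nsreg-p2 ROUND-47
v1.2 THEOREM K^Σ; cite: ConstantinIgnatovaVicol2026Putative, §3.4.1; folklore (length–area method)] -/
theorem summabilityLiouville_of
    (hW4' : (∀ (V : EuclideanSpace ℝ (Fin 3) → EuclideanSpace ℝ (Fin 3)) (ρ B q : ℝ) (ℓ : ℕ → ℝ), ContDiff ℝ 1 V → ρ < 1 → 1 < q →
      (∀ k : ℕ, 0 < ℓ k) → (∀ k : ℕ, q * ℓ k ≤ ℓ (k + 1)) → 0 ≤ B →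
      ∫⁻ y, ‖fderiv ℝ V y‖ₑ ^ 2 * ENNReal.ofReal (‖y‖ ^ (ρ - 1)) ≤ ENNReal.ofReal B →
      ∀ n : ℕ, ∑ k ∈ Finset.range n,
          (q * ℓ k) ^ (ρ - 1) *
            ((∫ z in ball (0 : EuclideanSpace ℝ (Fin 3)) (q * ℓ k), ‖fderiv ℝ V z‖ ^ 2) -
              ∫ z in ball (0 : EuclideanSpace ℝ (Fin 3)) (ℓ k), ‖fderiv ℝ V z‖ ^ 2) ≤ B))
    (hW4 : (∀ (F : ℝ → ℝ) (ρ κ q B : ℝ) (ℓ G : ℕ → ℝ), ρ < 1 → 1 < q → 0 < κ → (∀ k : ℕ, 0 < ℓ k) → (∀ k : ℕ, 0 < G k) →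
      (∀ n : ℕ, ∑ k ∈ Finset.range n, (q * ℓ k) ^ (ρ - 1) * (F (q * ℓ k) - F (ℓ k)) ≤ B) →
      (∀ k : ℕ, κ * ℓ k ^ 3 / G k ≤ F (q * ℓ k) - F (ℓ k)) →
      Summable (fun k : ℕ => ℓ k ^ (2 + ρ) / G k))) :
    ∀ (ρ : ℝ), 0 < ρ → ρ ≤ 1 / 2 →
      ∀ (u : ℝ → EuclideanSpace ℝ (Fin 3) → EuclideanSpace ℝ (Fin 3)) (p : ℝ → EuclideanSpace ℝ (Fin 3) → ℝ)
        (H : ℝ → EuclideanSpace ℝ (Fin 3) → EuclideanSpace ℝ (Fin 3) →L[ℝ] EuclideanSpace ℝ (Fin 3)) (c : ℝ≥0), 0 < (c : ℝ) →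
        IsSuitableWeakSolutionOn (slab (EuclideanSpace ℝ (Fin 3)) (Iio 0) isOpen_Iio) 0 0 u p →
        HasWeakSpatialGradientOn (slab (EuclideanSpace ℝ (Fin 3)) (Iio 0) isOpen_Iio) u H →
        (∀ a : ℝ, 0 < a →
          ENNReal.ofReal (a ^ (2 * ρ)) * cknA a (0 : ℝ × EuclideanSpace ℝ (Fin 3)) u +
              ENNReal.ofReal (a ^ ρ) * cknE a (0 : ℝ × EuclideanSpace ℝ (Fin 3)) H +
            ENNReal.ofReal (a ^ (2 * ρ)) * cknD a (0 : ℝ × EuclideanSpace ℝ (Fin 3)) p ≤ (c : ℝ≥0∞)) →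
        ∀ (V : EuclideanSpace ℝ (Fin 3) → EuclideanSpace ℝ (Fin 3)) (P : EuclideanSpace ℝ (Fin 3) → ℝ),
          (∀ τ : ℝ, τ < 0 → u τ = selfSimilarCollapse (1 / (2 + ρ)) 0 V τ) →
          (∀ τ : ℝ, τ < 0 → p τ = selfSimilarCollapsePressure (1 / (2 + ρ)) 0 P τ) →
          ContDiff ℝ 2 V →
          ∀ (G : ℝ → ℝ) (q R₀ : ℝ), 1 < q → 0 < R₀ → (∀ R : ℝ, R₀ ≤ R → 1 ≤ G R) →
            (∀ R : ℝ, R₀ ≤ R → ∀ z ∈ ball (0 : EuclideanSpace ℝ (Fin 3)) R, ‖fderiv ℝ V z‖ ≤ Real.exp (G R)) →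
            ¬ Summable (fun k : ℕ => (q ^ k * R₀) ^ (2 + ρ) / G (q ^ (k + 1) * R₀)) →
          uncurry u =ᵐ[volume.restrict (Iio (0 : ℝ) ×ˢ (univ : Set (EuclideanSpace ℝ (Fin 3))))] 0 := by
  intro ρ hρ hρ1 u p H c hc hsw hH hgauge V P hu hp hV G q R₀ hq hR₀ hG1 henv hdiv
  have hq0 : 0 < q := by linarith
  have hpow : ∀ k : ℕ, R₀ ≤ q ^ (k + 1) * R₀ := fun k => le_mul_of_one_le_left hR₀.le (one_le_pow₀ hq.le)
  have hmul : ∀ k : ℕ, q * (q ^ k * R₀) = q ^ (k + 1) * R₀ := fun k => by rw [pow_succ]; ring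
  refine selfSimilar_ae_eq_zero_of_windowDivergentC2_of hW4' hW4 hρ hρ1 hc hsw hH hgauge hu hp hV
    (ℓ := fun k => q ^ k * R₀) (G := fun k => G (q ^ (k + 1) * R₀)) hq (fun k => by positivity)
    (fun k => (hmul k).le) (fun k => hG1 _ (hpow k)) (fun k z hz => ?_) hdiv
  rw [hmul k] at hz
  exact henv _ (hpow k) z hz

end Summit.NavierStokesRegularity.NavierStokesRegularity.Theorems.PowerGaugeEulerLiouville.Condenser

end
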